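import Literature.NumberTheory.EllipticCurves.PoonenRainsKummerIsotropy
import Literature.NumberTheory.GaloisRepresentations.GaloisCohomologyKummerProofs
import HarnessLib

/-!
# Kummer isotropy for the Poonen–Rains form at level `2`, III: `q_L(κ(Q)) = 0`

Conclusion of `PoonenRainsKummerChords` / `PoonenRainsKummerIsotropy`: for `E/K` (model `W`, `2 ≠ 0`,
`char K = 0`), a `K`-field `L` and `Q ∈ E(L̄)` with `2Q ∈ E(L)`, the Poonen–Rains class of the local Kummer
class `κ(Q) ∈ H¹(Γ_L, E[2])` VANISHES:

  `prClass W h2 L (W.localKummerClass 2 _ Q hQ) = 0`      (`prClass_localKummerClass`),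

i.e. the image of `E(L)/2E(L)` in `H¹(L, E[2])` is isotropic for the Poonen–Rains quadratic map
(Poonen–Rains 2012 Prop. 4.8 / O'Neil 2002 Prop. 2.3), here with an EXPLICIT continuous splitting cochain:
`ℓ(σ) = s′_{ξσ} β / ((x_Q − e′_{ξσ}) σβ) ∈ {±1}`, `β² = η(Q) = 2y_Q + a₁x_Q + a₃` (`ell`, `ell_sq`,
`closureEmb_conn_eq_ell`), read in `μ₂(K̄)` (`bco`).  For `2Q = O` the Kummer cocycle is principal.
References: [PoonenRains2012] Prop. 4.8; [SilvermanAEC2009] VIII.§2, X.§4.  No named fact.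
-/

set_option autoImplicit false

noncomputable section

open scoped Classical

namespace Literature.NumberTheory.EllipticCurves

namespace ThetaLevelTwo

open Literature.Algebra.Homology
open Literature.NumberTheory.GaloisRepresentations Literature.NumberTheory.GaloisRepresentations.DiscreteGaloisModule
open Literature.NumberTheory.EllipticCurves.DokchitserDokchitser2012 (vec idx frame T xT eq_zero_or_eq_T)
open WeierstrassCurve Field

universe u

variable {K : Type u} [Field K] (W : WeierstrassCurve K) [W.IsElliptic] (h2 : (2 : K) ≠ 0)
variable (L : Type u) [Field L] [Algebra K L] [CharZero K]

/-! ### The sign cochain `ℓ` -/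

/-- The cochain `B(σ) = s′_{frame ξσ} / A_Q(frame ξσ)`. [cite: PoonenRains2012, Prop. 4.8 (isotropy of the Kummer image)] -/
def Bco (Q : localPoints W L) (hQ : (2 : ℤ) • Q ∈ MulAction.fixedPoints (absoluteGaloisGroup L) (localPoints W L))
    (xQ : AlgebraicClosure L) (σ : absoluteGaloisGroup L) : AlgebraicClosure L :=
  sL W h2 L (frame W h2 ((W.localKummerCocycle 2 two_ne_zero Q hQ).1 σ : geomTorsion W 2))
    / Aof (eL W h2 L) xQ (frame W h2 ((W.localKummerCocycle 2 two_ne_zero Q hQ).1 σ : geomTorsion W 2))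

/-- **The sign cochain** `ℓ(σ) = B(σ) · β / σβ` (`β² = η(Q)`). [cite: PoonenRains2012, Prop. 4.8 (isotropy of the Kummer image)] -/
def ell (Q : localPoints W L) (hQ : (2 : ℤ) • Q ∈ MulAction.fixedPoints (absoluteGaloisGroup L) (localPoints W L))
    (xQ β : AlgebraicClosure L) (σ : absoluteGaloisGroup L) : AlgebraicClosure L :=
  Bco W h2 L Q hQ xQ σ * β / (σ • β)

section Ell

variable (Q : localPoints W L) {xQ yQ : AlgebraicClosure L}
  (hQn : (W.baseChange (AlgebraicClosure L)).toAffine.Nonsingular xQ yQ)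
  (hQe : (Q : (W.baseChange (AlgebraicClosure L)).toAffine.Point) = Affine.Point.some xQ yQ hQn)
  (hQ : (2 : ℤ) • Q ∈ MulAction.fixedPoints (absoluteGaloisGroup L) (localPoints W L))
  (h2Q : Affine.Point.some xQ yQ hQn + Affine.Point.some xQ yQ hQn ≠ 0)
  {β : AlgebraicClosure L}
  (hβ : β ^ 2 = 2 * yQ + (W.baseChange (AlgebraicClosure L)).a₁ * xQ + (W.baseChange (AlgebraicClosure L)).a₃)

omit [W.IsElliptic] [CharZero K] in
include h2Q hβ in
/-- `β ≠ 0`. [cite: SilvermanAEC2009, III.2.3 (d) (doubling)] -/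
theorem beta_ne_zero : β ≠ 0 := by
  intro h
  apply eta_ne_zero_of_add_self_ne_zero W L hQn h2Q
  rw [← hβ, h, zero_pow two_ne_zero]

omit [W.IsElliptic] [CharZero K] in
include h2Q hβ in
/-- `σβ ≠ 0`. [cite: SilvermanAEC2009, III.2.3 (d) (doubling)] -/
theorem smul_beta_ne_zero (σ : absoluteGaloisGroup L) : σ • β ≠ 0 := by
  rw [smul_ne_zero_iff_ne]
  exact beta_ne_zero W L hQn h2Q hβ

omit [W.IsElliptic] [CharZero K] in
include hQe hβ in
/-- `(σβ)² = η(σQ)`. [cite: SilvermanAEC2009, VIII.§1 (Galois acts coordinatewise)] -/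
theorem smul_beta_sq (σ : absoluteGaloisGroup L) : (σ • β) ^ 2 = etaL W L (σ • Q) := by
  rw [← smul_pow', hβ, etaL_smul, etaL_of_eq W L hQe]

include hQe h2Q hβ in
/-- **`ℓ(σ)² = 1`**: for `ξσ = O` since `σQ = Q`; for `ξσ = Tᵢ` by the sign identity `div_sq_eq_one_of_chord`
with (Y) `etaL_smul_mul_sub` and `s′ᵢ² = −D′ᵢ`. [cite: PoonenRains2012, Prop. 4.8 (isotropy of the Kummer image)] -/
theorem ell_sq (σ : absoluteGaloisGroup L) : ell W h2 L Q hQ xQ β σ ^ 2 = 1 := by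
  have hβσ := smul_beta_ne_zero W L hQn h2Q hβ σ
  have hsq := smul_beta_sq W L Q hQn hQe hβ σ
  rcases eq_zero_or_eq_T W h2 ((W.localKummerCocycle 2 two_ne_zero Q hQ).1 σ) with h0 | ⟨i, hi⟩
  · -- `ξσ = O`: `σQ = Q`, `B = 1`, `(σβ)² = β²`
    have hQσ : σ • Q = Q := by
      rw [smul_eq_add_pointsMap W L Q hQ σ, h0, ZeroMemClass.coe_zero, map_zero, add_zero]
    rw [hQσ, etaL_of_eq W L hQe, ← hβ] at hsq
    have hB : Bco W h2 L Q hQ xQ σ = 1 := by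
      simp [Bco, h0, Aof]
    rw [ell, hB, one_mul, div_pow, hsq, div_self (pow_ne_zero 2 (beta_ne_zero W L hQn h2Q hβ))]
  · have hx : xQ ≠ eL W h2 L i := ne_eL_of_add_self_ne_zero W h2 L hQn h2Q i
    have hY := etaL_smul_mul_sub W h2 L Q hQn hQe hQ h2Q σ hi
    have hs := sL_vec_sq W h2 L i
    have hη : etaL W L (σ • Q) ≠ 0 := by
      rw [← hsq]; exact pow_ne_zero 2 hβσ
    have key := div_sq_eq_one_of_chord (e := eL W h2 L) (xR := xQ) (s := sL W h2 L (vec i)) i hx hs hY hβ hsq hη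
    have hidx : idx (vec i) = i := by fin_cases i <;> decide
    have hB : Bco W h2 L Q hQ xQ σ = sL W h2 L (vec i) / (xQ - eL W h2 L i) := by
      simp [Bco, hi, frame_T, Aof, hidx, show vec i ≠ 0 by fin_cases i <;> decide]
    rw [ell, hB, show sL W h2 L (vec i) / (xQ - eL W h2 L i) * β / (σ • β)
        = sL W h2 L (vec i) * β / ((xQ - eL W h2 L i) * (σ • β)) by rw [div_mul_eq_mul_div, div_div]]
    exact key

include hQe h2Q hβ in
/-- `ℓ(σ) = 1 ∨ ℓ(σ) = −1`. [cite: PoonenRains2012, Prop. 4.8 (isotropy of the Kummer image)] -/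
theorem ell_eq_one_or (σ : absoluteGaloisGroup L) : ell W h2 L Q hQ xQ β σ = 1 ∨ ell W h2 L Q hQ xQ β σ = -1 :=
  mul_self_eq_one_iff.mp (by rw [← pow_two]; exact ell_sq W h2 L Q hQn hQe hQ h2Q hβ σ)

include hQe h2Q hβ in
/-- `σ` fixes `ℓ(τ) ∈ {±1}`. [cite: PoonenRains2012, Prop. 4.8 (isotropy of the Kummer image)] -/
theorem smul_ell (σ τ : absoluteGaloisGroup L) : σ • ell W h2 L Q hQ xQ β τ = ell W h2 L Q hQ xQ β τ := by
  rcases ell_eq_one_or W h2 L Q hQn hQe hQ h2Q hβ τ with h | h <;> rw [h]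
  · exact smul_one σ
  · rw [smul_neg, smul_one]

include hQe h2Q hβ in
/-- **`ι(conn ξ (σ,τ)) = ℓ(σ) · σℓ(τ) / ℓ(στ)`**: the theta cocycle of the Kummer cocycle is the coboundary
of the sign cochain (from `closureEmb_conn_eq`, as `β/σβ` is a multiplicative coboundary).
[cite: PoonenRains2012, Prop. 4.8 (isotropy of the Kummer image)] -/
theorem closureEmb_conn_eq_ell (σ τ : absoluteGaloisGroup L) :
    closureEmb (K := K) L
        ((Additive.toMul (((heisenbergGm W h2).comap
          (absGaloisRestrict K L : absoluteGaloisGroup L →ₜ* absoluteGaloisGroup K).toMonoidHom).conn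
            (cocycleFun W L (W.localKummerCocycle 2 two_ne_zero Q hQ)) σ τ)
            : (AlgebraicClosure K)ˣ) : AlgebraicClosure K)
      = ell W h2 L Q hQ xQ β σ * (σ • ell W h2 L Q hQ xQ β τ) / ell W h2 L Q hQ xQ β (σ * τ) := by
  rw [closureEmb_conn_eq W h2 L Q hQn hQe hQ h2Q σ τ]
  have h1 := smul_beta_ne_zero W L hQn h2Q hβ σ
  have h2' := smul_beta_ne_zero W L hQn h2Q hβ τ
  have h3 := smul_beta_ne_zero W L hQn h2Q hβ (σ * τ)
  have h4 : σ • τ • β ≠ 0 := by rw [← mul_smul]; exact h3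
  have hβ0 : β ≠ 0 := beta_ne_zero W L hQn h2Q hβ
  have hx : ∀ i, xQ ≠ eL W h2 L i := ne_eL_of_add_self_ne_zero W h2 L hQn h2Q
  have hA := fun g => Aof_ne_zero (e := eL W h2 L) hx
    (frame W h2 ((W.localKummerCocycle 2 two_ne_zero Q hQ).1 g : geomTorsion W 2))
  have hs := fun g => sL_ne_zero W h2 L (frame W h2 ((W.localKummerCocycle 2 two_ne_zero Q hQ).1 g : geomTorsion W 2))
  have hA2 : σ • Aof (eL W h2 L) xQ (frame W h2 ((W.localKummerCocycle 2 two_ne_zero Q hQ).1 τ : geomTorsion W 2)) ≠ 0 := by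
    rw [smul_ne_zero_iff_ne]; exact hA τ
  have hs2 : σ • sL W h2 L (frame W h2 ((W.localKummerCocycle 2 two_ne_zero Q hQ).1 τ : geomTorsion W 2)) ≠ 0 := by
    rw [smul_ne_zero_iff_ne]; exact hs τ
  have hAσ := hA σ; have hAστ := hA (σ * τ); have hsσ := hs σ; have hsστ := hs (σ * τ)
  have hsd : ∀ a b : AlgebraicClosure L, σ • (a / b) = σ • a / σ • b := fun a b => by
    rw [div_eq_mul_inv, smul_mul', smul_inv'', div_eq_mul_inv]
  simp only [ell, Bco, hsd, smul_mul', ← mul_smul]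
  field_simp

end Ell

/-! ### Reading `ℓ` in `μ₂(K̄)` -/

/-- The evaluation `μ₂(K̄) → L̄`, `z ↦ ι(z)` (multiplicative reading of the additive carrier).
[cite: SerreGaloisCohomology1997, II §1.2 (μₙ ⊂ K̄ˣ)] -/
def muToL (z : MuCarrier K 2) : AlgebraicClosure L :=
  closureEmb (K := K) L (muVal K 2 z : AlgebraicClosure K)

omit [CharZero K] in
/-- `muToL (z + z′) = muToL z · muToL z′`. [cite: SerreGaloisCohomology1997, II §1.2 (μₙ ⊂ K̄ˣ)] -/
theorem muToL_add (z z' : MuCarrier K 2) : muToL (K := K) L (z + z') = muToL L z * muToL L z' := by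
  simp only [muToL, muVal_add, Units.val_mul, map_mul]

omit [CharZero K] in
/-- `muToL 0 = 1`. [cite: SerreGaloisCohomology1997, II §1.2 (μₙ ⊂ K̄ˣ)] -/
@[simp] theorem muToL_zero : muToL (K := K) L 0 = 1 := by
  simp [muToL]

omit [CharZero K] in
/-- `muToL (z − z′) = muToL z / muToL z′`. [cite: SerreGaloisCohomology1997, II §1.2 (μₙ ⊂ K̄ˣ)] -/
theorem muToL_sub (z z' : MuCarrier K 2) : muToL (K := K) L (z - z') = muToL L z / muToL L z' := by
  simp only [muToL, muVal_sub, Units.val_div_eq_div_val, map_div₀]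

omit [CharZero K] in
/-- `muToL` is injective. [cite: SerreGaloisCohomology1997, II §1.2 (μₙ ⊂ K̄ˣ)] -/
theorem muToL_injective : Function.Injective (muToL (K := K) L) := fun _ _ h =>
  muVal_injective K 2 (Units.ext ((closureEmb (K := K) L).injective h))

omit [CharZero K] in
/-- Equivariance: `muToL (θσ · z) = σ (muToL z)`. [cite: SerreGaloisCohomology1997, II §1.2 (μₙ as a Galois module)] -/
theorem muToL_mu (σ : absoluteGaloisGroup L) (z : MuCarrier K 2) :
    muToL (K := K) L (mu K 2 (absGaloisRestrict K L σ) z) = σ • muToL L z := by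
  simp only [muToL, muVal_apply, Units.coe_smul, closureEmb_smul]

omit [CharZero K] in
/-- The local Poonen–Rains cochain read in `L̄`: `muToL (conn_μ ξ (σ,τ)) = ι(conn_{Gm} ξ (σ,τ))`.
[cite: PoonenRains2012, Cor. 4.6 (the quadratic form q : H¹(A[λ]) → H²(G_m))] -/
theorem muToL_localDatum_conn (ξ : absoluteGaloisGroup L → geomTorsion W 2) (σ τ : absoluteGaloisGroup L) :
    muToL (K := K) L ((localDatum W h2 L).conn ξ σ τ)
      = closureEmb (K := K) L ((Additive.toMul (((heisenbergGm W h2).comap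
          (absGaloisRestrict K L : absoluteGaloisGroup L →ₜ* absoluteGaloisGroup K).toMonoidHom).conn ξ σ τ)
            : (AlgebraicClosure K)ˣ) : AlgebraicClosure K) := by
  rw [HeisenbergDatum.conn_apply, HeisenbergDatum.conn_apply, muToL_add, toMul_add, Units.val_mul, map_mul]
  congr 1

/-- `−1 ∈ μ₂(K̄)` as an element of the carrier. [cite: SerreGaloisCohomology1997, II §1.2 (μₙ ⊂ K̄ˣ)] -/
def negOneMu : MuCarrier K 2 :=
  MuCarrier.ofRootsOfUnity ⟨-1, by rw [mem_rootsOfUnity]; norm_num⟩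

omit [CharZero K] in
/-- `muToL (−1) = −1`. [cite: SerreGaloisCohomology1997, II §1.2 (μₙ ⊂ K̄ˣ)] -/
@[simp] theorem muToL_negOneMu : muToL (K := K) L (negOneMu (K := K)) = -1 := by
  simp only [muToL, negOneMu, muVal_ofRootsOfUnity, Units.val_neg, Units.val_one, map_neg, map_one]

/-! ### The splitting cochain `b` and the conclusion -/

section Conclusion

variable (Q : localPoints W L) {xQ yQ : AlgebraicClosure L}
  (hQn : (W.baseChange (AlgebraicClosure L)).toAffine.Nonsingular xQ yQ)
  (hQe : (Q : (W.baseChange (AlgebraicClosure L)).toAffine.Point) = Affine.Point.some xQ yQ hQn)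
  (hQ : (2 : ℤ) • Q ∈ MulAction.fixedPoints (absoluteGaloisGroup L) (localPoints W L))
  (h2Q : Affine.Point.some xQ yQ hQn + Affine.Point.some xQ yQ hQn ≠ 0)
  {β : AlgebraicClosure L}
  (hβ : β ^ 2 = 2 * yQ + (W.baseChange (AlgebraicClosure L)).a₁ * xQ + (W.baseChange (AlgebraicClosure L)).a₃)

/-- **The splitting cochain in `μ₂(K̄)`**: `b(σ) = ℓ(σ) ∈ {±1}` read back in `μ₂(K̄)`.
[cite: PoonenRains2012, Prop. 4.8 (isotropy of the Kummer image)] -/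
def bco (β : AlgebraicClosure L) (σ : absoluteGaloisGroup L) : MuCarrier K 2 :=
  if ell W h2 L Q hQ xQ β σ = 1 then 0 else negOneMu

include hQe h2Q hβ in
/-- `muToL (b σ) = ℓ(σ)`. [cite: PoonenRains2012, Prop. 4.8 (isotropy of the Kummer image)] -/
theorem muToL_bco (σ : absoluteGaloisGroup L) : muToL L (bco W h2 L Q hQ (xQ := xQ) β σ) = ell W h2 L Q hQ xQ β σ := by
  unfold bco
  split_ifs with h
  · rw [h, muToL_zero]
  · rcases ell_eq_one_or W h2 L Q hQn hQe hQ h2Q hβ σ with h1 | h1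
    · exact absurd h1 h
    · rw [h1, muToL_negOneMu]

/-- `ℓ` only depends on `ξ_σ` and `σβ` (local constancy data). [cite: PoonenRains2012, Prop. 4.8 (isotropy of the Kummer image)] -/
theorem ell_congr {σ σ₀ : absoluteGaloisGroup L}
    (hξ : (W.localKummerCocycle 2 two_ne_zero Q hQ).1 σ = (W.localKummerCocycle 2 two_ne_zero Q hQ).1 σ₀)
    (hs : σ • β = σ₀ • β) :
    ell W h2 L Q hQ xQ β σ = ell W h2 L Q hQ xQ β σ₀ := by
  simp only [ell, Bco, hξ, hs]

include h2Q hβ in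
/-- `b` is continuous (locally constant). [cite: SerreGaloisCohomology1997, I §2.2 (continuous cochains)] -/
theorem continuous_bco : Continuous (bco W h2 L Q hQ (xQ := xQ) β) := by
  rw [continuous_discrete_rng]
  intro c
  rw [isOpen_iff_forall_mem_open]
  intro σ₀ hσ₀
  have hβ0 : β ≠ 0 := beta_ne_zero W L hQn h2Q hβ
  refine ⟨{σ | (W.localKummerCocycle 2 two_ne_zero Q hQ).1 σ = (W.localKummerCocycle 2 two_ne_zero Q hQ).1 σ₀}
      ∩ {σ | σ • ((Units.mk0 β hβ0 : (AlgebraicClosure L)ˣ) : AlgebraicClosure L) = σ₀ • β}, ?_, ?_, ?_⟩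
  · intro σ hσ
    simp only [Set.mem_inter_iff, Set.mem_setOf_eq, Units.val_mk0] at hσ
    simp only [Set.mem_preimage, Set.mem_singleton_iff] at hσ₀ ⊢
    rw [← hσ₀, bco, bco, ell_congr W h2 L Q hQ hσ.1 hσ.2]
  · exact ((isOpen_discrete {(W.localKummerCocycle 2 two_ne_zero Q hQ).1 σ₀}).preimage
      (W.localKummerCocycle 2 two_ne_zero Q hQ).1.continuous).inter (isOpen_setOf_smul_eq _ _)
  · exact ⟨rfl, by simp⟩

include hQe h2Q hβ in
/-- **The Poonen–Rains cocycle of the Kummer cocycle of `Q` (`2Q ≠ O`) is the coboundary of `b`.**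
[cite: PoonenRains2012, Prop. 4.8 (isotropy of the Kummer image)] -/
theorem prCocycle_localKummerCocycle_eq_coboundary (σ τ : absoluteGaloisGroup L) :
    (prCocycle W h2 L (W.localKummerCocycle 2 two_ne_zero Q hQ)).1 (σ, τ)
      = (DiscreteGaloisModule.toTopRep (GaloisRep.restrictField L (mu K 2))).ρ σ (bco W h2 L Q hQ (xQ := xQ) β τ)
        - bco W h2 L Q hQ (xQ := xQ) β (σ * τ) + bco W h2 L Q hQ (xQ := xQ) β σ := by
  apply muToL_injective (K := K) L
  rw [prCocycle_apply, muToL_localDatum_conn, closureEmb_conn_eq_ell W h2 L Q hQn hQe hQ h2Q hβ σ τ,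
    muToL_add, muToL_sub, toTopRep_mu_ρ_apply, muToL_mu,
    muToL_bco W h2 L Q hQn hQe hQ h2Q hβ, muToL_bco W h2 L Q hQn hQe hQ h2Q hβ,
    muToL_bco W h2 L Q hQn hQe hQ h2Q hβ]
  ring

end Conclusion

omit [W.IsElliptic] [CharZero K] in
/-- A nonzero point has affine coordinates. [cite: SilvermanAEC2009, III.2.3 (coordinates of points)] -/
theorem exists_eq_some_of_ne_zero (P : localPoints W L) (hP : P ≠ 0) :
    ∃ (x y : AlgebraicClosure L) (h : (W.baseChange (AlgebraicClosure L)).toAffine.Nonsingular x y),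
      (P : (W.baseChange (AlgebraicClosure L)).toAffine.Point) = Affine.Point.some x y h := by
  change (W.baseChange (AlgebraicClosure L)).toAffine.Point at P
  rcases P with _ | ⟨x, y, h⟩
  · exact absurd rfl hP
  · exact ⟨x, y, h, rfl⟩

/-- The local Kummer cocycle of a point `Q` with `2Q = O` is principal. [cite: SilvermanAEC2009, VIII.§2 (the Kummer pairing)] -/
theorem localKummerCocycle_apply_of_two_torsion (Q : localPoints W L)
    (hQ : (2 : ℤ) • Q ∈ MulAction.fixedPoints (absoluteGaloisGroup L) (localPoints W L))
    (h2Q : (2 : ℤ) • Q = 0) (σ : absoluteGaloisGroup L) :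
    ((W.localKummerCocycle 2 two_ne_zero Q hQ).1 σ : geomTorsion W 2)
      = absGaloisRestrict K L σ • (W.torsionPointsEquiv 2 (E := L) two_ne_zero).symm
          ⟨Q, show (2 : ℤ) • Q = 0 from h2Q⟩
        - (W.torsionPointsEquiv 2 (E := L) two_ne_zero).symm ⟨Q, show (2 : ℤ) • Q = 0 from h2Q⟩ := by
  rw [← resGal_eq_absGaloisRestrict, ← torsionPointsEquiv_symm_smul, ← map_sub]
  rfl

/-- **Kummer images are isotropic for the Poonen–Rains form** (Poonen–Rains 2012 Prop. 4.8 / O'Neil 2002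
Prop. 2.3, at level `2`, with an explicit splitting): for every `Q ∈ E(L̄)` with `2Q ∈ E(L)`,
`q_L(κ(Q)) = 0`. [cite: PoonenRains2012, Prop. 4.8 (the image of A(k)/λA(k) is isotropic for q)] -/
theorem prClass_localKummerClass (Q : localPoints W L)
    (hQ : (2 : ℤ) • Q ∈ MulAction.fixedPoints (absoluteGaloisGroup L) (localPoints W L)) :
    prClass W h2 L (W.localKummerClass 2 two_ne_zero Q hQ) = 0 := by
  haveI : CompactSpace (absoluteGaloisGroup L) := absoluteGaloisGroup_compactSpace L
  unfold localKummerClass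
  rw [prClass_oneCocycleClass]
  by_cases h2Q0 : (2 : ℤ) • Q = 0
  · -- `2Q = O`: the Kummer cocycle is principal, so its PR cocycle is cohomologous to `prCocycle 0 = 0`
    rw [twoCocycleClass_prCocycle_eq_of_sub_principal W h2 L 0 (W.localKummerCocycle 2 two_ne_zero Q hQ)
      ((W.torsionPointsEquiv 2 (E := L) two_ne_zero).symm ⟨Q, show (2 : ℤ) • Q = 0 from h2Q0⟩)
      (fun σ => by
        rw [cocycleFun_apply, cocycleFun_apply, localKummerCocycle_apply_of_two_torsion W L Q hQ h2Q0 σ,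
          Submodule.coe_zero, ContinuousMap.zero_apply, zero_add]),
      prCocycle_zero, twoCocycleClass_zero]
    rfl
  · -- `2Q ≠ O`: coordinates of `Q`, a square root of `η(Q)`, and the explicit coboundary
    have hQ0 : Q ≠ 0 := by rintro rfl; exact h2Q0 (smul_zero _)
    obtain ⟨xQ, yQ, hQn, hQe⟩ := exists_eq_some_of_ne_zero W L Q hQ0
    have h2Q : Affine.Point.some xQ yQ hQn + Affine.Point.some xQ yQ hQn ≠ 0 := by
      intro h
      apply h2Q0
      rw [two_zsmul]
      rw [← hQe] at h
      exact h
    obtain ⟨β, hβ⟩ := IsAlgClosed.exists_pow_nat_eq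
      (2 * yQ + (W.baseChange (AlgebraicClosure L)).a₁ * xQ + (W.baseChange (AlgebraicClosure L)).a₃) two_pos
    exact (twoCocycleClass_eq_zero_iff _ _).mpr
      ⟨⟨bco W h2 L Q hQ (xQ := xQ) β, continuous_bco W h2 L Q hQn hQ h2Q hβ⟩,
        fun σ τ => prCocycle_localKummerCocycle_eq_coboundary W h2 L Q hQn hQe hQ h2Q hβ σ τ⟩

end ThetaLevelTwo

end Literature.NumberTheory.EllipticCurves
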